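import Summits.QuantumFields.GaugeBoot.TiltedSiteRPHolonomy
import HarnessLib

/-!
# Axis flips of a periodic lattice: invariance of the Wilson measure (gauge-boot, L3(υ) supplement)

HONEST FRAMING (cell `pub-gaugeboot`, page 1 of every file): the venture produces certified bounds
on lattice expectations at stated coupling, gauge group, dimension and torus size; NOT a mass gap,
NOT a continuum limit, NOT a string tension; NOT Yang–Mills-summit-bearing (barriers
`FixedCouplingUltralocality`, `PerturbativeInvisibility`).

The SYMMETRY input of the lattice bootstrap (Kazakov–Zheng arXiv:2203.11360 §3.3: the expectation
values are invariant under the lattice symmetries, which is what reduces the SDP) in the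
periodic-lattice setting of `TiltedLatticeGauge.lean`. An **axis flip** of a periodic lattice
`(A, e)` in direction `k` is an additive involution `σ : A →+ A` with `σ (e k) = -e k` and
`σ (e l) = e l` for `l ≠ k` (`IsAxisFlip`; no height, no layer axiom — this is the part of a site
frame `IsSiteFrame` of `TiltedSiteRPGeometry.lean` that does not concern positivity, and every site
frame is an axis flip, `IsSiteFrame.isAxisFlip`). The induced map of configurations is the one of
the site reflection, `configReflect e k σ` (`k`-links reversed and inverted), and the Wilson measure
is invariant under it for EVERY real `β`:

* `IsAxisFlip.wilsonAction_configReflect` — `S(ΘU) = S(U)` (plaquettes are permuted by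
  `plaqReflect`, holonomies conjugated and inverted);
* `IsAxisFlip.measurePreserving_configReflect` — `Θ` preserves the product Haar measure;
* `IsAxisFlip.integral_comp_configReflect_gibbs` — `∫ F(ΘU) dμ_β = ∫ F dμ_β`, real and complex
  observables.

On the 45°-tilted box this gives the flips `x_k ↦ -x_k` along every axis `k ∉ {i, j}` for EVERY
period `L` (the site frame needed `L = 2Q`, `Q ≥ 2`), and along the axes `i`, `j` themselves when
`M_u = M_v` (`TiltedBoxAxisFlips.lean`), whence the anti-diagonal mirror `x_i = -x_j`. The proofs are
those of `TiltedSiteRPHolonomy.lean` / `TiltedSiteRPPositivity.lean`, which used only these three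
axioms of the site frame.

References: V. Kazakov, Z. Zheng, arXiv:2203.11360 §3.3; K. Osterwalder, E. Seiler, Ann. Phys. 110
(1978) 440, §2 (the reflection of configurations).
-/

noncomputable section

open MeasureTheory
open Literature.MathematicalPhysics.QuantumFieldTheory (haarProbability)
open Literature.RepresentationTheory.CompactGroups

namespace Summit.QuantumFields.GaugeBoot

namespace TiltedRP

open IsSiteFrame (plaqReflect plaqReflect_fst_of_hasDir plaqReflect_fst_of_not_hasDir plaqReflect_snd
  configReflect_eq_comp)

variable {A : Type*} [AddCommGroup A] {d : ℕ}

/-- **An axis flip** of the periodic lattice `(A, e)` in direction `k`: an additive involution `σ`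
with `σ (e k) = -e k` and `σ (e l) = e l` for `l ≠ k`. -/
structure IsAxisFlip (e : Fin d → A) (k : Fin d) (σ : A →+ A) : Prop where
  /-- The flip reverses `e k`. -/
  map_e_self : σ (e k) = -e k
  /-- The flip fixes the other translations. -/
  map_e_other : ∀ l, l ≠ k → σ (e l) = e l
  /-- The flip is an involution. -/
  invol : ∀ x, σ (σ x) = x

/-- Every site frame is an axis flip. -/
theorem IsSiteFrame.isAxisFlip {e : Fin d → A} {k : Fin d} {σ : A →+ A} {P : ℕ}
    {h : A →+ ZMod (2 * P)} (hF : IsSiteFrame e k σ P h) : IsAxisFlip e k σ :=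
  ⟨hF.map_e_self, hF.map_e_other, hF.invol⟩

namespace IsAxisFlip

variable {e : Fin d → A} {k : Fin d} {σ : A →+ A}
variable (hF : IsAxisFlip e k σ)
include hF

/-! ## The flip on sites, links, configurations, plaquettes -/

/-- `σ (x + e k) = σ x - e k`. -/
theorem map_add_self (x : A) : σ (x + e k) = σ x - e k := by
  rw [map_add, hF.map_e_self, sub_eq_add_neg]

/-- `σ (x + e l) = σ x + e l` for `l ≠ k`. -/
theorem map_add_other (x : A) {l : Fin d} (hl : l ≠ k) : σ (x + e l) = σ x + e l := by
  rw [map_add, hF.map_e_other l hl]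

/-- `σ (x - e k) = σ x + e k`. -/
theorem map_sub_self (x : A) : σ (x - e k) = σ x + e k := by
  rw [map_sub, hF.map_e_self, sub_neg_eq_add]

/-- `siteLinkMap` is an involution. -/
theorem siteLinkMap_siteLinkMap (l : Link A d) : siteLinkMap e k σ (siteLinkMap e k σ l) = l := by
  obtain ⟨x, m⟩ := l
  by_cases hm : m = k
  · subst hm
    rw [siteLinkMap_self, siteLinkMap_self, hF.map_sub_self, hF.invol, add_sub_cancel_right]
  · rw [siteLinkMap_other e k σ x hm, siteLinkMap_other e k σ _ hm, hF.invol]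

/-- `siteLinkMap` is involutive. -/
theorem siteLinkMap_involutive : Function.Involutive (siteLinkMap (d := d) e k σ) :=
  hF.siteLinkMap_siteLinkMap

/-- `configReflect` is an involution. -/
theorem configReflect_configReflect {G : Type*} [Group G] (U : Config A d G) :
    configReflect e k σ (configReflect e k σ U) = U := by
  funext l
  obtain ⟨x, m⟩ := l
  by_cases hm : m = k
  · subst hm
    rw [configReflect_self, configReflect_self, hF.map_sub_self, hF.invol, add_sub_cancel_right,
      inv_inv]
  · rw [configReflect_other e k σ _ x hm, configReflect_other e k σ U _ hm, hF.invol]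

/-- `plaqReflect` is an involution. -/
theorem plaqReflect_plaqReflect (p : Plaq A d) : plaqReflect e k σ (plaqReflect e k σ p) = p := by
  obtain ⟨x, q⟩ := p
  by_cases hp : HasDir (x, q) k
  · have hp' : HasDir (plaqReflect e k σ (x, q)) k := hp
    ext1
    · rw [plaqReflect_fst_of_hasDir hp', plaqReflect_fst_of_hasDir hp]
      simp only
      rw [hF.map_sub_self, hF.invol, add_sub_cancel_right]
    · rfl
  · have hp' : ¬ HasDir (plaqReflect e k σ (x, q)) k := hp
    ext1
    · rw [plaqReflect_fst_of_not_hasDir hp', plaqReflect_fst_of_not_hasDir hp]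
      exact hF.invol x
    · rfl

/-! ## Holonomies and the action under the flip -/

section Holonomy

variable {N : ℕ} {G : Type*} [Group G]

/-- A plaquette WITHOUT `k`-side: `(ΘU)_{x;l,m} = U_{σx;l,m}`. -/
theorem holonomy_configReflect_of_not_hasDir (U : Config A d G) {p : Plaq A d} (hp : ¬ HasDir p k) :
    holonomy e (configReflect e k σ U) p.1 p.2.1.1 p.2.1.2 =
      holonomy e U (plaqReflect e k σ p).1 p.2.1.1 p.2.1.2 := by
  obtain ⟨x, ⟨⟨l, m⟩, hlm⟩⟩ := p
  simp only [HasDir, not_or] at hp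
  rw [plaqReflect_fst_of_not_hasDir (by simpa [HasDir] using hp)]
  simp only [holonomy, configReflect_other e k σ _ _ hp.1, configReflect_other e k σ _ _ hp.2,
    hF.map_add_other _ hp.1, hF.map_add_other _ hp.2]

/-- A `(k, m)`-plaquette: `(ΘU)_{x;k,m} = a⁻¹ · (U_{y;k,m})⁻¹ · a`, `y = σx - e_k`, `a = U(y, k)`. -/
theorem holonomy_configReflect_left (U : Config A d G) (x : A) {m : Fin d} (hm : m ≠ k) :
    holonomy e (configReflect e k σ U) x k m =
      (U (σ x - e k, k))⁻¹ * (holonomy e U (σ x - e k) k m)⁻¹ * U (σ x - e k, k) := by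
  have h1 : configReflect e k σ U (x + e k, m) = U (σ x - e k, m) := by
    rw [configReflect_other e k σ U _ hm, hF.map_add_self]
  have h2 : configReflect e k σ U (x + e m, k) = (U (σ x - e k + e m, k))⁻¹ := by
    rw [configReflect_self, hF.map_add_other _ hm, add_sub_right_comm]
  have h3 : configReflect e k σ U (x, m) = U (σ x - e k + e k, m) := by
    rw [configReflect_other e k σ U _ hm, sub_add_cancel]
  simp only [holonomy, configReflect_self, h1, h2, h3, mul_inv_rev, inv_inv]
  group

/-- An `(l, k)`-plaquette: `(ΘU)_{x;l,k} = a⁻¹ · (U_{y;l,k})⁻¹ · a`, `y = σx - e_k`, `a = U(y, k)`. -/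
theorem holonomy_configReflect_right (U : Config A d G) (x : A) {l : Fin d} (hl : l ≠ k) :
    holonomy e (configReflect e k σ U) x l k =
      (U (σ x - e k, k))⁻¹ * (holonomy e U (σ x - e k) l k)⁻¹ * U (σ x - e k, k) := by
  have h1 : configReflect e k σ U (x + e l, k) = (U (σ x - e k + e l, k))⁻¹ := by
    rw [configReflect_self, hF.map_add_other _ hl, add_sub_right_comm]
  have h2 : configReflect e k σ U (x + e k, l) = U (σ x - e k, l) := by
    rw [configReflect_other e k σ U _ hl, hF.map_add_self]
  have h3 : configReflect e k σ U (x, l) = U (σ x - e k + e k, l) := by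
    rw [configReflect_other e k σ U _ hl, sub_add_cancel]
  simp only [holonomy, configReflect_self, h1, h2, h3, mul_inv_rev, inv_inv]
  group

/-- A plaquette WITH a `k`-side: `(ΘU)_p = a⁻¹ · (U_{p'})⁻¹ · a`, `p' = plaqReflect p`. -/
theorem holonomy_configReflect_of_hasDir (U : Config A d G) {p : Plaq A d} (hp : HasDir p k) :
    holonomy e (configReflect e k σ U) p.1 p.2.1.1 p.2.1.2 =
      (U (σ p.1 - e k, k))⁻¹ * (holonomy e U (plaqReflect e k σ p).1 p.2.1.1 p.2.1.2)⁻¹ *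
        U (σ p.1 - e k, k) := by
  obtain ⟨x, ⟨⟨l, m⟩, hlm⟩⟩ := p
  have hlm' : l ≠ m := ne_of_lt hlm
  rw [plaqReflect_fst_of_hasDir hp]
  simp only [HasDir] at hp
  rcases hp with hl | hm
  · have hl' := hl.symm
    subst hl'
    exact hF.holonomy_configReflect_left U x (fun h' => hlm' h'.symm)
  · have hm' := hm.symm
    subst hm'
    exact hF.holonomy_configReflect_right U x hlm'

variable [TopologicalSpace G] [IsTopologicalGroup G] [CompactSpace G]
variable (ρ : G →* Matrix (Fin N) (Fin N) ℂ)

/-- **`Re tr ρ((ΘU)_p) = Re tr ρ(U_{plaqReflect p})`.** -/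
theorem plaqObs_configReflect (hρ : Continuous ρ) (p : Plaq A d) (U : Config A d G) :
    plaqObs ρ e p (configReflect e k σ U) = plaqObs ρ e (plaqReflect e k σ p) U := by
  unfold plaqObs
  rw [plaqReflect_snd]
  by_cases hp : HasDir p k
  · rw [hF.holonomy_configReflect_of_hasDir U hp]
    set a := U (σ p.1 - e k, k)
    set g := holonomy e U (plaqReflect e k σ p).1 p.2.1.1 p.2.1.2
    rw [show a⁻¹ * g⁻¹ * a = a⁻¹ * g⁻¹ * a⁻¹⁻¹ by rw [inv_inv], CompactGroup.trace_conj_eq,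
      CompactGroup.re_trace_map_inv ρ hρ]
  · rw [hF.holonomy_configReflect_of_not_hasDir U hp]

/-- **The Wilson action is invariant under the flip**: `S(ΘU) = S(U)` (plaquettes are permuted by
the involution `plaqReflect`). -/
theorem wilsonAction_configReflect [Fintype A] (hρ : Continuous ρ) (U : Config A d G) :
    wilsonAction ρ e (configReflect e k σ U) = wilsonAction ρ e U := by
  rw [wilsonAction_eq, wilsonAction_eq]
  congr 1
  exact Fintype.sum_equiv (Function.Involutive.toPerm (plaqReflect e k σ) hF.plaqReflect_plaqReflect)
    _ _ fun p => hF.plaqObs_configReflect ρ hρ p U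

end Holonomy

/-! ## The flip preserves the product Haar measure and the Wilson measure -/

section Measure

variable [Fintype A] {N : ℕ} {G : Type*} [Group G] [TopologicalSpace G] [IsTopologicalGroup G]
  [CompactSpace G] [MeasurableSpace G] [BorelSpace G]
variable (ρ : G →* Matrix (Fin N) (Fin N) ℂ)

/-- The reflection of links as a permutation. -/
def linkPerm (hF : IsAxisFlip e k σ) : Equiv.Perm (Link A d) :=
  Function.Involutive.toPerm (siteLinkMap e k σ) hF.siteLinkMap_involutive

/-- **The flip preserves the product Haar measure** (relabelling of the links composed with the
inversion of the `k`-link variables; Haar measure of a compact group is inversion invariant). -/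
theorem measurePreserving_configReflect :
    MeasurePreserving (configReflect (G := G) e k σ) (productHaar A d G) (productHaar A d G) := by
  haveI : IsProbabilityMeasure (haarProbability G) :=
    CompactGroup.isProbabilityMeasure_haarMeasure_top
  haveI : (haarProbability G).IsInvInvariant := by
    unfold haarProbability; exact CompactGroup.isInvInvariant_of_isHaarMeasure _
  have h1 : MeasurePreserving (fun U l => U (siteLinkMap e k σ l) : Config A d G → Config A d G)
      (productHaar A d G) (productHaar A d G) := by
    have h' := measurePreserving_arrowCongr' (fun _ : Link A d => haarProbability G)
      (fun _ : Link A d => haarProbability G) hF.linkPerm (MeasurableEquiv.refl G)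
      fun _ => MeasurePreserving.id _
    have heq : (fun U l => U (siteLinkMap e k σ l) : Config A d G → Config A d G) =
        ⇑(MeasurableEquiv.arrowCongr' hF.linkPerm (MeasurableEquiv.refl G)) := by
      funext U l; rfl
    rw [heq]; exact h'
  have h2 : MeasurePreserving
      (fun V l => (if l.2 = k then (fun g : G => g⁻¹) else id) (V l) : Config A d G → Config A d G)
      (productHaar A d G) (productHaar A d G) := by
    unfold productHaar
    refine measurePreserving_pi _ _ fun l => ?_
    split_ifs
    · exact Measure.measurePreserving_inv _
    · exact MeasurePreserving.id _
  rw [configReflect_eq_comp]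
  exact h2.comp h1

variable [SecondCountableTopology G]

/-- **Flip invariance of the Wilson measure**: `∫ F(ΘU) dμ_β = ∫ F dμ_β` (measurable real `F`,
every real `β`). -/
theorem integral_comp_configReflect_gibbs (hρ : Continuous ρ) (β : ℝ) {F : Config A d G → ℝ}
    (hFm : Measurable F) :
    ∫ U, F (configReflect e k σ U) ∂(gibbs ρ e β) = ∫ U, F U ∂(gibbs ρ e β) := by
  rw [integral_gibbs, integral_gibbs]
  set Z := ∫ U, Real.exp (-β * wilsonAction ρ e U) ∂(productHaar A d G)
  have h1 : ∀ U : Config A d G, (Real.exp (-β * wilsonAction ρ e U) / Z) • F (configReflect e k σ U) =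
      (fun V : Config A d G => (Real.exp (-β * wilsonAction ρ e V) / Z) • F V)
        (configReflect e k σ U) := by
    intro U
    simp only [hF.wilsonAction_configReflect ρ hρ]
  have hm : Measurable fun V : Config A d G => (Real.exp (-β * wilsonAction ρ e V) / Z) • F V :=
    (((continuous_boltzmann ρ hρ e β).measurable).div_const _).smul hFm
  simp_rw [h1]
  rw [← integral_map hF.measurePreserving_configReflect.measurable.aemeasurable
    hm.aestronglyMeasurable, hF.measurePreserving_configReflect.map_eq]

/-- Flip invariance of the Wilson measure, complex observables. -/
theorem integral_comp_configReflect_gibbs_complex (hρ : Continuous ρ) (β : ℝ) {F : Config A d G → ℂ}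
    (hFm : Measurable F) :
    ∫ U, F (configReflect e k σ U) ∂(gibbs ρ e β) = ∫ U, F U ∂(gibbs ρ e β) := by
  rw [integral_gibbs, integral_gibbs]
  set Z := ∫ U, Real.exp (-β * wilsonAction ρ e U) ∂(productHaar A d G)
  have h1 : ∀ U : Config A d G, (Real.exp (-β * wilsonAction ρ e U) / Z) • F (configReflect e k σ U) =
      (fun V : Config A d G => (Real.exp (-β * wilsonAction ρ e V) / Z) • F V)
        (configReflect e k σ U) := by
    intro U
    simp only [hF.wilsonAction_configReflect ρ hρ]
  have hm : Measurable fun V : Config A d G => (Real.exp (-β * wilsonAction ρ e V) / Z) • F V :=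
    (((continuous_boltzmann ρ hρ e β).measurable).div_const _).smul hFm
  simp_rw [h1]
  rw [← integral_map hF.measurePreserving_configReflect.measurable.aemeasurable
    hm.aestronglyMeasurable, hF.measurePreserving_configReflect.map_eq]

end Measure

end IsAxisFlip

end TiltedRP

end Summit.QuantumFields.GaugeBoot
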